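import Summits.FinalStateConjecture.FinalStateConjecture.Theorems.NearExtremalKappaCapture.Negative.ExponentMonotonicity
import Summits.FinalStateConjecture.FinalStateConjecture.Theorems.NearExtremalKappaCapture.Negative.SubextremalRedundancy
import Summits.FinalStateConjecture.FinalStateConjecture.Theorems.NearExtremalKappaCapture.Negative.TruncationTraps
import Summits.FinalStateConjecture.FinalStateConjecture.Theorems.NearExtremalKappaCapture.Negative.ExtremalGerm
import Literature.Geometry.Lorentzian.KerrSliceFacts

/-!
# Disproof of `NearExtremalKappaCapture` — findings (cdisprove, crux stmt-FinalStateConjecture-10606,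
# route PhaseMixingCapture; v4.2, cycle 3, refuter-cdisprove-stmt-FinalStateConjecture-10606-g3-0, 2026-08-16)

VERDICT SO FAR: **no kill; the crux resists in Lean for a structural reason and on paper for a
mathematical one** — and (v4.1) the admissible exponent region is bracketed from BOTH sides by
kernel-checked reductions. DICTIONARY (v4.1; §9): the typed `dist` is a NORM of the data
difference, so `dist ≍ amplitude`, radiated `(E, J) ≍ dist²`, and the modulus `Cχ^{-p}√dist` is
Hölder-½. Modulo the standard conjectural picture the region is, per norm class,
`δ < 1/2` (spin unpinned): `{γ ≥ 1} × {p ≥ −γ/2}`; `δ ≥ 1/2` (all charges pinned):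
`{γ ≥ 1/2} × {p ≥ −3γ/2}` (up-sets; the edge value of `γ` only with a small basin constant).

ERRATUM (v4, published 03:49Z and its evidence note, superseded here): v4 claimed the third-law
fork is "ORDER ONE in every norm" and called the tree's "`γ < 1/2`" a slip. Wrong dictionary: with
`dist ≍ amplitude` the RADIATIVE route to extremality costs `dist ≍ √χ` (order ½ — the value in
`ExponentMonotonicity` §4, whose parenthetical "`√dist ∼` amplitude" should read "`dist ∼`
amplitude"), while the MEMBER route (`Kerr(M, a')`, `a' ≥ M`, restricted to the slice) is order
ONE but exists only where the spin is unpinned (`δ < 1/2`). Likewise the drift edge is `p = −γ/2`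
only where a parameter is unpinned and `p = −3γ/2` in pinned norms. The Lean theorems of v4 were
parametric and remain; §§9–10 below are re-stated with explicit orders (`θ`, `q`).

v1–v2.2 (cycle 1) and v3–v3.4 (cycle 2) are LANDED and imported here instead of being repeated:
* `Negative/ExponentMonotonicity.lean` (p73006): §0 `near_iff` (read-back), §2 `captureWith_mono`
  (admissible exponent vectors form an UP-SET), `near_iff_diagonal`, `not_near_iff` (a disproof must
  show SUPER-POLYNOMIAL degeneration), §3 `captureWith_self` (`dist = 0` pins `M' = M`, `a' = a`),
  §4 `ExtremalFormationInBasin` / `captureWith_false_of_extremalFormation` (third-law fork).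
* `Negative/SubextremalRedundancy.lean` (p74448, triage r1): `near_iff_withoutSub` — for the ∃-crux
  the conjunct `Kerr.IsSubextremal M' a'` is FREE (modulus + up-set, `γ ↦ max γ (2p+2)`).
* `Literature/…/KerrSliceFacts.lean` (p74113): `Kerr.sliceFacts_holds`; with `Kerr.Facts` (three
  tree theorems) BOTH instance binders are discharged ⇒ the crux is the bare ∃ (`near_iff_exists`).
* `Negative/ExtremalGerm.lean` (p76844/p77058): §5 `captureWith_plainOn`, `captureWith_iff_tail`,
  `near_iff_germ` / `not_near_iff_germ` (granted bulk plain capture the crux is a statement about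
  the punctured neighbourhoods `a₂M ≤ |a| < M`, `a₂ → 1` — the RATE of degeneration only; a
  counterexample family must ACCUMULATE at `|a| = M` and defeat every exponent), §8
  `captureWith_of_linear` (a Lipschitz modulus `C·dist` gives the typed modulus with `p = −γ/2`).
* `Negative/TruncationTraps.lean` (p76436/p76857): §6 `TruncationTrap θ` +
  `captureWith_false_of_truncationTrap` (a trap of order `θ` refutes every `γ < θ`); explicit
  Kerr-family traps ON PAPER: mass `Kerr(M − η, a)`, `η > Mχ/2` (order 1, finite distance iff
  `δ < −1/2`; formalised modulo three facts: `captureWith_false_of_lighterMembers`), translation /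
  tilt (order 1/2, `δ < 1/2`), boost (order 1/4), NONE for `δ ≥ 1/2`;
  `captureWith_zero_false_of_truncationTrap` (no κ-UNIFORM basin in any trapped norm).

NEW IN v4 (this file, §§9–11; LANDED this cycle, accepted: §9 = `Negative/ThresholdTraps.lean`
(p81611, commit 6a7a1a82833c), §10 = `Negative/ModulusLowerEdge.lean` (p81802, commit e624a110b385) —
kept inline below only until the farm snapshot builds them; then import and delete the copies):
* §9 THRESHOLD TRAPS (the basin edge through the sub-extremality conjunct, with orders):
  `ExtremalFormationInBasin.anti` (the fork is antitone in `γ`); `ThresholdTrap θ` (order-`θ`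
  family of data with NO sub-extremal Kerr limit) ⇒ `extremalFormation_of_thresholdTrap` (every
  `γ < θ`) ⇒ `captureWith_false_of_thresholdTrap`; conversely `ExtremalFormationCost θ`
  (non-capturable data cost `dist ≥ Mχ^θ/K`) ⇒ `not_extremalFormation_of_cost` (every `γ ≥ θ`).
  On paper (trap order = cost order, so the fork's threshold is EXACT): `θ = 1` where the spin is
  unpinned (`δ < 1/2`: the members `Kerr(M, a')`, `a' ≥ M`, on the slice, `dist ≍ a' − a ≳ χ`;
  rigidity of the limit), `θ = 1/2` in every norm and sharp for pinned `δ ≥ 1/2` (radiating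
  `E ≍ dist² ≥ M − √(aM) ≥ Mχ/4`, `extremalityGap_ge`; realisability = AKU's threshold leaf /
  Kehle–Unger-type extremal formation). With the truncation traps (§6: order 1 for `δ < −1/2`,
  1/2 for `δ < 1/2`) and the YZL onset (`h₀ ≍ κ̂`, i.e. `dist ≍ √χ`, order ½): `γ ≥ 1` is
  necessary for `δ < 1/2`, `γ ≥ 1/2` for `δ ≥ 1/2`; sufficiency at the same values is what AKU's
  Conjecture 1 (+ Lipschitz final parameters along the family, `δ < 1/2`) resp. a κ-uniform
  quadratic bound on radiated `(E, J)` (pinned norms) would give.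
* §10 DRIFT FAMILIES (the lower edge of `p`, with orders): `DriftFamily q` (at every near-extremal
  spin and every small amplitude `ε` a vacuum datum with `dist < ε` whose Kerr limits all have
  `|M' − M| + |a' − a| ≥ c₀ε^q`) ⇒ `captureWith_false_of_drift`: every `p < −(2q − 1)γ/2` is
  refuted (`γ ≥ 0`, `q > 1/2`; primed version for all `γ`). `q = 1` where a parameter is unpinned
  (heavier members `Kerr(M + η, a)`, `δ < −1/2`, formalised modulo three facts as
  `driftFamily_one_of_members` ⇒ `captureWith_false_of_members`; spin-shifted members for
  `δ < 1/2`): edge `p = −γ/2`, sharp with §8 (`modulusLine_sharp`); `q = 2` in pinned norms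
  (quadratic radiation through `𝓘⁺`): edge `p = −3γ/2`. So `p` records only the conversion
  between the drift law and `√dist` at the basin scale; no κ-information lives in it.
* §11 TARGETS (registered skeleton `Lines/unit-temperature-front-face.lean`, 4 stubs; lead's PICKED
  line `polynomial-closure`, whose stubs 1/3 the drefute seat found mis-typed): no stub is false AS
  TYPED by a cheap attack (details in the §11 docblock: S1/S2 numerically certified by three seats;
  S3 = anchored Cauchy stability for thermal time, consistent near the slice edge `r = M` because
  `r` and `t*` are both time functions there with margin `|g(∇r,∇r)| = M²χ/Σ` — polynomial; S4 is
  crux-complete relative to `S3 ∧ KappaExplicitWaveDecay`, so it inherits this file's verdict).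

* STRUCTURAL (why no `¬` can be landed today; unchanged, re-verified v4 against the grown tree).
  Every conclusion sits under `∀ 𝒟 : VacuumCauchyDevelopment D, 𝒟.IsMaximal → …`;
  `VacuumCauchyDevelopment` demands `IsCauchyHypersurface (range embed)` and `IsMaximal` that EVERY
  vacuum Cauchy development embed into `𝒟` (CauchyDevelopment.lean), so junk developments are
  neither maximal nor an obstruction to maximality. MGHD existence is in the tree only as the named
  fact `choquetBruhat_geroch_exists_mghd_cauchy` (AdmissibleMGHDExistence.lean; reductions in
  MGHDExistenceReduction.lean / CauchyProblemMGHDExistenceProofs.lean; the one CONSTRUCTED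
  development is Minkowski's, MinkowskiCauchyDevelopment.lean) — an abstract MGHD carries no
  geometry, so even "¬ modulo MGHD existence" cannot see far-incompleteness or a non-Kerr limit.
  The new re-basing API (`CauchyDevelopmentComap.lean`, `InitialDataHomothety.lean`) would let the
  translation fork of §6 be typed (translate `Kerr.data M a r₀'` by `d·e_z`, `comap` to
  `Kerr.slice a M`), but only modulo the same two paper facts as the mass fork (distance `≍ d`,
  `δ < 1/2`; MGHD not far-complete for `d > M√χ`) and at the WEAKER order `1/2`: not formalised.
  Read-back of the remaining binders (v3): `[D.metric.HasLeviCivita]`, `[𝒟.metric.HasLeviCivita]`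
  are theorems; `IsNormalisedNullRayFrom` demands a MAXIMAL future null geodesic with `γ 0 = ι q`;
  `ConvergesToKerr 𝒟oc M' a' k` at `k = 0` is codimension-0 `C⁰`-almost-isometry of whole slabs
  `{r > r₊'}`, rigid on paper, so `(M', a')` is pinned up to `a' ↦ −a'` and no junk truth arises.
* MATHEMATICAL (why it resists on paper; pages read cycles 2–3). (1) Sub-extremal Kerr is
  nonlinearly stable at every FIXED `|a| < M` (Hintz arXiv:2606.28253, Thm 1.1 p. 2; Rem. 1.4 p. 5:
  the inputs failing at `|a| = M` — r-normally hyperbolic trapping, red-shift — degenerate at a RATE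
  `∝ κ`; p. 20: expected false AT extremality). By §5 the crux is then EXACTLY a statement about the
  rate at which basin and modulus degenerate as `a₂ → 1`. (2) THE NEAREST EXPERT CONJECTURE IMPLIES
  THE CRUX: Angelopoulos–Kehle–Unger arXiv:2603.10378, Conj. 1 (p. 12; vacuum Kerr included): a
  uniform NEIGHBOURHOOD of the extremal datum with (i) Kerr(–Newman) universality of black-hole
  end states and no naked singularity (⇒ far-completeness), (ii) a `C¹` isologous foliation with
  the extremal leaf as threshold, (iii) "a generic near-threshold solution will experience a
  transient instability on the timescale of its inverse final temperature" (`≍ κ⁻¹`, POLYNOMIAL).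
  Granted Conj. 1 in a topology where the Kerr family is continuous (`δ < 1/2`) with Lipschitz
  final parameters, `CaptureWith` holds at `(γ, p) = (1, −1/2)` (§8): A KILL OF THE CRUX WOULD
  REFUTE AKU's CONJECTURE 1 FOR VACUUM KERR. (3) EVERY PRINTED
  NEAR-EXTREMAL RATE IS POLYNOMIAL, including the 2025–26 literature read this cycle: East, PRL 136
  (2026) 151401 = arXiv:2511.20567 (numerical GR at the extremal critical point, Einstein–Maxwell–
  Vlasov: instability time `τ ≈ M[2(1 − Q*/M)]^{-1/2} ≈ κ⁻¹`, dispersal time `T ∼ M(Q/M − 1)^{-1/2}`,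
  pp. 4–5; the Kerr analogue conjectured with the same exponent from `λ/ω₀ ≈ 2Mκ`, p. 5); Gajic
  arXiv:2603.28861 §1.1.6 p. 7 (near-extremal RN, charged scalars: transient horizon maxima
  `≍ κ₊^{−1/2−k+Re β₀/2}` on `δ₁κ⁻¹ ≤ τ ≤ δ₂κ⁻¹`, fixed `(ℓ, m)`); Benomio–Teixeira da Costa
  arXiv:2512.08917 (Maxwell on the FULL range `|a| ≤ M`: Thm 5.1 p. 26 non-degenerate energies with
  `C(a₀) → ∞` as `a₀ → M`; Conj. 5.6 pp. 26–27 UNIFORM-in-`a` boundedness/decay in degenerate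
  energies at fixed azimuthal `m`; Rem. 5.8 p. 27: "very few uniform-in-a statements exist … only
  [SRT20] for the radial ODE away from the superradiant threshold"); earlier: Casals–Gralla–
  Zimmerman arXiv:1606.08505 pp. 3, 8 (`κ̂⁻¹` energy amplification), Gajic arXiv:2302.06636 pp. 3,
  4, 10, YZL arXiv:1402.4859 pp. 3–4 (onset amplitude `h₀ ≍ κ̂`, i.e. `dist ≍ √χ`: the `γ = 1/2`
  edge, §9), TdC CMP 378 (2020) Prop. 6.3. (4) THE ONLY SHAPE OF A KILL (`not_near_iff`):
  super-polynomial degeneration — mode-wise amplification `κ^{-cm}` in the uncharted corner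
  `m → ∞`, `|ω − mω₊| ≪ |m|` (every uniform-in-`a` statement in print is at FIXED `m`: B–TdC Conj.
  5.6; AKU p. 16: "summing over m is a significant challenge … even pointwise boundedness for
  general solutions to the wave equation on extremal Kerr remains a fundamental open problem"), or
  an `exp(c/κ)` / Gevrey price in the nonlinear scheme. Nothing of the kind is in print.

NOT PROVED / near-misses: reflection blindness `Kerr(M, a) ≅ Kerr(M, −a)` (paper); "vacuum
constraints are decoration" (Gauss–Codazzi; no development ⇒ constraints theorem in the tree); a
`¬` modulo MGHD existence (an abstract MGHD has no geometry; the honest H would be the instability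
statement itself, of which none is in print).
-/

noncomputable section

set_option linter.dupNamespace false

namespace Summit.FinalStateConjecture.FinalStateConjecture.Cruxes.NearExtremalKappaCapture.Disproof

open Literature.Geometry.Lorentzian
open Summit.FinalStateConjecture.FinalStateConjecture.Theorems.NearExtremalKappaCapture.Negative
open scoped Manifold ContDiff Topology ENNReal
open Set Filter

/-! ## §1  No binder shields anything: instances and the Levi-Civita hypotheses are theorems -/

/-- `Kerr.Facts` is inhabited (three tree theorems). [folklore] -/
instance kerrFacts : Kerr.Facts :=
  ⟨Kerr.isConnected_region_holds, Kerr.contMDiff_bilin_holds, Kerr.contMDiff_timeVector_holds⟩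

/-- `Kerr.SliceFacts` is inhabited (`Kerr.sliceFacts_holds`, Literature/…/KerrSliceFacts.lean,
p74113, cycle 1 of this seat). Hence BOTH instance binders of the crux are dischargeable and the
crux is LITERALLY `∃ (s δ k γ p a₁), a₁ < 1 ∧ CaptureWith s δ k γ p a₁` (`near_iff_exists`). -/
instance sliceFacts : Kerr.SliceFacts :=
  Kerr.sliceFacts_holds

/-- The standing hypothesis `[D.metric.HasLeviCivita]` of the crux's data binder is a theorem for
EVERY initial data set (`PseudoRiemannianMetric.hasLeviCivita`): it filters nothing. -/
theorem hasLeviCivita_data {a M : ℝ} (D : InitialDataSet 𝓘(ℝ, E3) (Kerr.slice a M)) :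
    D.metric.HasLeviCivita :=
  D.metric.hasLeviCivita

/-- … and so is the binder `[𝒟.metric.HasLeviCivita]` inside the far-completeness clause: every
development's metric has its Levi-Civita connection. -/
theorem hasLeviCivita_dev {a M : ℝ} {D : InitialDataSet 𝓘(ℝ, E3) (Kerr.slice a M)}
    (𝒟 : VacuumCauchyDevelopment D) : 𝒟.metric.HasLeviCivita :=
  𝒟.metric.toPseudoRiemannianMetric.hasLeviCivita

/-- Hence the clause `FarComplete 𝒟` is equivalent to its instance-free body (read with THE
Levi-Civita connection): no conclusion is vacuously true for want of an instance. -/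
theorem farComplete_iff {a M : ℝ} {D : InitialDataSet 𝓘(ℝ, E3) (Kerr.slice a M)}
    (𝒟 : VacuumCauchyDevelopment D) [𝒟.metric.HasLeviCivita] :
    FarComplete 𝒟 ↔
      ∃ B₀ : Set (Kerr.slice a M), IsCompact B₀ ∧ ∀ σ : ℝ, 0 < σ →
        ∃ B₁ : Set (Kerr.slice a M), IsCompact B₁ ∧
          ∀ q ∈ {q : Kerr.slice a M | Kerr.afRadius a M + 1 ≤ ‖(q : E3)‖}, q ∉ B₁ →
            ∀ (ray : ℝ → 𝒟.carrier) (dom : Set ℝ),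
              𝒟.metric.IsNormalisedNullRayFrom 𝒟.timeOrientation 𝒟.embed 𝒟.normal q ray dom →
                ¬ BddAbove dom ∨ ENNReal.ofReal σ ≤
                  sojournTime ray dom
                    (𝒟.metric.causalFuture 𝒟.timeOrientation (𝒟.embed '' B₀)) := by
  constructor
  · intro h
    exact h
  · intro h _
    exact h

/-! ## §7  The crux as a bare first-order statement -/

/-- With both instances in the tree the crux is the bare existential over exponent vectors. -/
theorem near_iff_exists :
    Theses.PhaseMixingCapture.NearExtremalKappaCapture ↔
      ∃ (s : ℕ) (δ : ℝ) (k : ℕ) (γ p a₁ : ℝ), a₁ < 1 ∧ CaptureWith s δ k γ p a₁ :=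
  ⟨fun h ↦ h, fun h _ _ ↦ h⟩

/-- … and its negation is the bare universal statement: for every `a₁ < 1` and every `N`, capture
with basin `cχ^N`, modulus `Cχ^{-N}√dist`, norm `H^N_N` and `C⁰` convergence fails. -/
theorem not_near_iff' :
    ¬ Theses.PhaseMixingCapture.NearExtremalKappaCapture ↔
      ∀ (a₁ : ℝ) (N : ℕ), a₁ < 1 → ¬ CaptureWith N (N : ℝ) 0 (N : ℝ) (N : ℝ) a₁ :=
  not_near_iff

/-- (v3 §5, landed) The germ localisation with the instances of §1 supplied: granted bulk plain
capture, the crux ↔ every tail `a₂M ≤ |a| < M` is captured at some diagonal exponent. -/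
theorem near_iff_germ' (hbulk : BulkPlainCapture) :
    Theses.PhaseMixingCapture.NearExtremalKappaCapture ↔
      ∀ a₂ : ℝ, a₂ < 1 → ∃ N : ℕ, CaptureWith N (N : ℝ) 0 (N : ℝ) (N : ℝ) a₂ :=
  near_iff_germ hbulk

/-! ## §9  Threshold traps: the basin edge through the sub-extremality conjunct

DICTIONARY (settles the exponent slips of earlier versions): `dataWeightedSobolevEDist` is a NORM of
the difference of the data components (WeightedNorms.lean: `(∑ ∫ (1+|x|)^{2(δ+m)}‖Dᵐ·‖²)^{1/2}`),
so `dist ≍ amplitude` of the perturbation (exactly linear along a fixed profile), radiated energy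
and angular momentum are `≍ amplitude² ≍ dist²`, and the typed modulus `Cχ^{-p}√dist` is a
HÖLDER-½ modulus. A Kerr parameter is "unpinned" in `H^s_δ` when moving it costs finite distance:
the mass for `δ < −1/2` (`r⁻¹` tails), the spin / centre / axis for `δ < 1/2` (`r⁻²` tails);
for `δ ≥ 1/2` all Poincaré charges are pinned and data at finite distance from `Kerr.data M a M`
carry exactly the charges `(M, aM)`. -/

/-- `ExtremalFormationInBasin` is ANTItone in the basin exponent: non-subextremal limits forming
inside every `cχ^{γ'}`-basin form inside every `cχ^γ`-basin, `γ ≤ γ'` (`χ^{γ'} ≤ χ^γ` on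
`(0, 1]`). So the set of `γ` reached by the third-law fork is a DOWN-set and has a threshold. -/
theorem ExtremalFormationInBasin.anti {s : ℕ} {δ γ γ' a₁ : ℝ}
    (h : ExtremalFormationInBasin s δ γ' a₁) (hγ : γ ≤ γ') : ExtremalFormationInBasin s δ γ a₁ := by
  obtain ⟨M, hM, h⟩ := h
  refine ⟨M, hM, fun c hc ↦ ?_⟩
  obtain ⟨a, ha, hsub, D, inst, hvac, hdist, 𝒟, hmax, hlim⟩ := h c hc
  obtain ⟨hx0, hx1⟩ := kappaSq_pos_le_one hsub
  refine ⟨a, ha, hsub, D, inst, hvac, hdist.trans_le (ENNReal.ofReal_le_ofReal ?_), 𝒟, hmax, hlim⟩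
  exact mul_le_mul_of_nonneg_left (Real.rpow_le_rpow_of_exponent_ge hx0 hx1 hγ) hc.le

/-- **A threshold trap of order `θ`** (`ThresholdTrap θ s δ a₁`): for every `M > 0` there is `K`
such that at every spin `a₁M ≤ |a| < M` some vacuum datum on `Kerr.slice a M` lies within
`dist_{s,δ} ≤ Kχ^θ` (`χ = 1 − a²/M²`) of the Kerr datum and has a maximal vacuum Cauchy
development NONE of whose Kerr–Schild `C⁰`-limits `(M', a')` is sub-extremal — the
`IsSubextremal M' a'`-analogue of `TruncationTrap θ` (which negates `FarComplete` instead).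
ON PAPER: (a) ORDER ONE for `δ < 1/2` (spin unpinned): the non-subextremal MEMBERS `Kerr(M, a')`,
`a' ≥ M` (Kerr–Schild time slice `{x⁰ = 0}`, same `E3`) restricted to `Kerr.slice a M` — smooth
there (the ring `{ρ = a', z = 0}` has `r_a = √(a'² − a²) < M`), differing from `Kerr.data M a M`
by `(a' − a)·∂_a(h, k) = O((a' − a)r⁻²)`, so `dist ≍ a' − a ≥ M − a = Mχ/(1 + a/M)`; for
`a' = M` the edge `{r_a = M}` has `r_M ∈ [a, M]` (inside the extremal horizon except at the
poles; checked numerically), the MGHD contains the whole exterior future and IS `Kerr(M, a')`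
there, which converges to no sub-extremal Kerr in `C⁰` on full slabs (rigidity). (b) ORDER ½ in
every norm, in particular for pinned `δ ≥ 1/2`: radiative tuning onto the extremal threshold leaf
of AKU's Conjecture 1 (ii) — with charges `(M, aM)` pinned, an extremal hole forms only after
radiating `E = M − √(aM − J_rad) ≥ M − √(aM) ≥ Mχ/4` (`extremalityGap_ge`; counter-rotating
emission `J_rad < 0` helps but is itself `O(amplitude²)`), i.e. at `amplitude² ≍ dist² ≍ χ`,
`dist ≍ √χ` (realisability = Kehle–Unger-type extremal Kerr formation in vacuum: open; model
theorems arXiv:2402.10190, numerics at the critical point arXiv:2511.20567).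
[cite: KehleUnger2024] -/
def ThresholdTrap (θ : ℝ) (s : ℕ) (δ a₁ : ℝ) : Prop :=
  ∀ (M : ℝ) (hM : 0 < M), ∃ K : ℝ, ∀ a : ℝ, a₁ * M ≤ |a| → |a| < M →
    ∃ (D : InitialDataSet 𝓘(ℝ, E3) (Kerr.slice a M)) (_ : D.metric.HasLeviCivita),
      D.IsVacuumConstraintSolution ∧
        InitialDataSet.dataWeightedSobolevEDist s δ D (Kerr.data M a M hM.le) ≤
            ENNReal.ofReal (K * (1 - (a / M) ^ 2) ^ θ) ∧
          ∃ 𝒟 : VacuumCauchyDevelopment D, 𝒟.IsMaximal ∧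
            ∀ (M' a' : ℝ) (𝒟oc : Set 𝒟.carrier),
              𝒟.toSpacetime.ConvergesToKerr 𝒟oc M' a' 0 → ¬ Kerr.IsSubextremal M' a'

/-- Threshold traps are monotone: a trap of order `θ` is a trap of every order `θ' ≤ θ`
(`χ^θ ≤ χ^θ'` on `(0, 1]`), of every weaker norm `s' ≤ s`, `δ' ≤ δ`, and of every smaller spin
range (verbatim `TruncationTrap.mono`). -/
theorem ThresholdTrap.mono {θ θ' : ℝ} {s s' : ℕ}
    {δ δ' a₁ a₁' : ℝ} (h : ThresholdTrap θ s δ a₁) (hθ : θ' ≤ θ) (hs : s' ≤ s) (hδ : δ' ≤ δ)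
    (ha : a₁ ≤ a₁') : ThresholdTrap θ' s' δ' a₁' := by
  intro M hM
  obtain ⟨K, hK⟩ := h M hM
  refine ⟨max K 0, fun a ha' haM ↦ ?_⟩
  obtain ⟨D, inst, hvac, hle, 𝒟, hmax, hlim⟩ :=
    hK a ((mul_le_mul_of_nonneg_right ha hM.le).trans ha') haM
  obtain ⟨hx0, hx1⟩ := kappaSq_pos_le_one (show Kerr.IsSubextremal M a from haM)
  refine ⟨D, inst, hvac, ?_, 𝒟, hmax, hlim⟩
  calc InitialDataSet.dataWeightedSobolevEDist s' δ' D (Kerr.data M a M hM.le)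
      ≤ InitialDataSet.dataWeightedSobolevEDist s δ D (Kerr.data M a M hM.le) :=
        dataWeightedSobolevEDist_mono hs hδ _ _
    _ ≤ ENNReal.ofReal (K * (1 - (a / M) ^ 2) ^ θ) := hle
    _ ≤ ENNReal.ofReal (max K 0 * (1 - (a / M) ^ 2) ^ θ') := by
        refine ENNReal.ofReal_le_ofReal ?_
        calc K * (1 - (a / M) ^ 2) ^ θ ≤ max K 0 * (1 - (a / M) ^ 2) ^ θ :=
              mul_le_mul_of_nonneg_right (le_max_left _ _) (Real.rpow_nonneg hx0.le _)
          _ ≤ max K 0 * (1 - (a / M) ^ 2) ^ θ' :=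
              mul_le_mul_of_nonneg_left (Real.rpow_le_rpow_of_exponent_ge hx0 hx1 hθ)
                (le_max_right _ _)

/-- **A threshold trap of order `θ` puts non-subextremal limits inside every basin of exponent
`γ < θ`** (`a₁ < 1`): at `M = 1`, given `c`, choose `χ` with `Kχ^θ < cχ^γ` and the spin
`a = √(1 − χ)`. The computation is that of `captureWith_false_of_truncationTrap`. -/
theorem extremalFormation_of_thresholdTrap {θ : ℝ} {s : ℕ} {δ γ a₁ : ℝ} (ha₁ : a₁ < 1)
    (hT : ThresholdTrap θ s δ a₁) (hγ : γ < θ) : ExtremalFormationInBasin s δ γ a₁ := by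
  refine ⟨1, one_pos, fun c hc ↦ ?_⟩
  obtain ⟨K, hK⟩ := hT 1 one_pos
  -- constants
  set K' : ℝ := max K 0 + 1 with hK'
  have hK'pos : 0 < K' := by positivity
  have hKK' : K ≤ K' := by simp [hK']; linarith [le_max_left K 0]
  set a₀ : ℝ := max a₁ 0 with ha₀
  have ha₀0 : 0 ≤ a₀ := le_max_right _ _
  have ha₀1 : a₀ < 1 := max_lt ha₁ one_pos
  have hx₀ : 0 < 1 - a₀ ^ 2 := by nlinarith
  set e : ℝ := θ - γ with he
  have he0 : 0 < e := by linarith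
  set q : ℝ := c / (2 * K') with hq
  have hq0 : 0 < q := by positivity
  set χ₁ : ℝ := q ^ (1 / e) with hχ₁
  have hχ₁0 : 0 < χ₁ := Real.rpow_pos_of_pos hq0 _
  set χ : ℝ := min χ₁ (1 - a₀ ^ 2) with hχdef
  have hχ0 : 0 < χ := lt_min hχ₁0 hx₀
  have hχle : χ ≤ 1 - a₀ ^ 2 := min_le_right _ _
  -- `χ^e ≤ q`, hence `K' χ^θ ≤ (c/2) χ^γ < c χ^γ`
  have hχe : χ ^ e ≤ q := by
    calc χ ^ e ≤ χ₁ ^ e := Real.rpow_le_rpow hχ0.le (min_le_left _ _) he0.le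
      _ = q := by
          rw [hχ₁, ← Real.rpow_mul hq0.le, one_div_mul_cancel he0.ne', Real.rpow_one]
  have hsplit : χ ^ θ = χ ^ e * χ ^ γ := by
    rw [← Real.rpow_add hχ0, he, sub_add_cancel]
  have hχγ0 : 0 < χ ^ γ := Real.rpow_pos_of_pos hχ0 _
  have hχθ0 : 0 ≤ χ ^ θ := Real.rpow_nonneg hχ0.le _
  have hKχ : K' * χ ^ θ < c * χ ^ γ := by
    calc K' * χ ^ θ = (K' * χ ^ e) * χ ^ γ := by rw [hsplit, mul_assoc]
      _ ≤ (K' * q) * χ ^ γ :=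
          mul_le_mul_of_nonneg_right (mul_le_mul_of_nonneg_left hχe hK'pos.le) hχγ0.le
      _ = (c / 2) * χ ^ γ := by rw [hq]; field_simp
      _ < c * χ ^ γ := by nlinarith
  -- the spin and the trapped datum
  obtain ⟨ha₀a, ha1, haχ⟩ := spin_of_kappaSq hχ0 ha₀0 hχle
  set a : ℝ := √(1 - χ) with ha_def
  have ha0 : 0 ≤ a := Real.sqrt_nonneg _
  have habs : |a| = a := abs_of_nonneg ha0
  have ha₁a : a₁ * 1 ≤ |a| := by rw [mul_one, habs]; exact (le_max_left _ _).trans ha₀a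
  have hsub : Kerr.IsSubextremal 1 a := by show |a| < 1; rwa [habs]
  have hχa : 1 - (a / 1) ^ 2 = χ := by rw [div_one]; exact haχ
  obtain ⟨D, inst, hvacD, hle, 𝒟, hmax, hlim⟩ := hK a ha₁a (by rwa [habs])
  refine ⟨a, ha₁a, hsub, D, inst, hvacD, ?_, 𝒟, hmax, hlim⟩
  refine hle.trans_lt ((ENNReal.ofReal_lt_ofReal_iff (by rw [hχa]; positivity)).mpr ?_)
  rw [hχa]
  calc K * χ ^ θ ≤ K' * χ ^ θ := mul_le_mul_of_nonneg_right hKK' hχθ0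
    _ < c * χ ^ γ := hKχ

/-- **A threshold trap of order `θ` refutes every basin exponent `γ < θ`** (all `k, p`), through
the conjunct `Kerr.IsSubextremal M' a'` (landed `captureWith_false_of_extremalFormation`). With
the paper traps of the docstring of `ThresholdTrap`: `γ ≥ 1` is necessary whenever the spin is
unpinned (`δ < 1/2` — including the mass-pinned range `−1/2 ≤ δ < 1/2`, where the truncation traps
of §6 only reach order `1/2`), and `γ ≥ 1/2` is necessary in EVERY norm. -/
theorem captureWith_false_of_thresholdTrap {θ : ℝ} {s : ℕ} {δ : ℝ} {k : ℕ} {γ p a₁ : ℝ}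
    (ha₁ : a₁ < 1) (hT : ThresholdTrap θ s δ a₁) (hγ : γ < θ) : ¬ CaptureWith s δ k γ p a₁ :=
  captureWith_false_of_extremalFormation (extremalFormation_of_thresholdTrap ha₁ hT hγ) k p

/-- **`ExtremalFormationCost θ s δ a₁`** — the price, of order `θ`, of leaving the sub-extremal
class: for every `M > 0` there is `K > 0` such that at every spin `a₁M ≤ |a| < M`, every vacuum
datum on `Kerr.slice a M` having a maximal development with NO sub-extremal Kerr–Schild
`C⁰`-limit lies at distance `≥ Mχ^θ/K` from the Kerr datum. ON PAPER (dictionary above): `θ = 1`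
for `δ < 1/2` (the cheapest route is the member `Kerr(M, M)` at `dist ≍ M − a ≍ χ`; every
radiative route costs `dist ≳ √χ ≫ χ`), and `θ = 1/2` for pinned `δ ≥ 1/2` (`E_rad ≍ dist² ≥
M − √(aM) ≥ Mχ/4`, `extremalityGap_ge`). [folklore] -/
def ExtremalFormationCost (θ : ℝ) (s : ℕ) (δ a₁ : ℝ) : Prop :=
  ∀ (M : ℝ) (hM : 0 < M), ∃ K > (0 : ℝ), ∀ a : ℝ, a₁ * M ≤ |a| → Kerr.IsSubextremal M a →
    ∀ (D : InitialDataSet 𝓘(ℝ, E3) (Kerr.slice a M)) [D.metric.HasLeviCivita],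
      D.IsVacuumConstraintSolution →
        (∃ 𝒟 : VacuumCauchyDevelopment D, 𝒟.IsMaximal ∧
          ∀ (M' a' : ℝ) (𝒟oc : Set 𝒟.carrier),
            𝒟.toSpacetime.ConvergesToKerr 𝒟oc M' a' 0 → ¬ Kerr.IsSubextremal M' a') →
          ENNReal.ofReal (M * (1 - (a / M) ^ 2) ^ θ / K) ≤
            InitialDataSet.dataWeightedSobolevEDist s δ D (Kerr.data M a M hM.le)

/-- **Granted a cost of order `θ`, the third-law fork is BARRED for every `γ ≥ θ`** (with basin
constant `c = M/K` at the mass `M` of the fork): `Mχ^θ/K ≤ dist < cχ^γ ≤ (M/K)χ^θ` is absurd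
(`χ^γ ≤ χ^θ` on `(0, 1]`). With `extremalFormation_of_thresholdTrap` the fork's threshold is
EXACTLY the common order of trap and cost: `γ = 1` for `δ < 1/2`, `γ = 1/2` for `δ ≥ 1/2`.
(`ExponentMonotonicity` §4's "energetically plausible exactly when `γ < 1/2`" is the pinned-norm
value — its parenthetical "`√dist ∼` amplitude" should read "`dist ∼` amplitude" — and misses the
order-one member fork available whenever the spin is unpinned.) -/
theorem not_extremalFormation_of_cost {θ : ℝ} {s : ℕ} {δ γ a₁ : ℝ}
    (hcost : ExtremalFormationCost θ s δ a₁) (hγ : θ ≤ γ) : ¬ ExtremalFormationInBasin s δ γ a₁ := by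
  rintro ⟨M, hM, h⟩
  obtain ⟨K, hK, hcost⟩ := hcost M hM
  obtain ⟨a, ha, hsub, D, inst, hvac, hdist, 𝒟, hmax, hlim⟩ := h (M / K) (by positivity)
  haveI := inst
  obtain ⟨hx0, hx1⟩ := kappaSq_pos_le_one hsub
  have hle := hcost a ha hsub D hvac ⟨𝒟, hmax, hlim⟩
  have hlt := hle.trans_lt hdist
  have hq : 0 < M / K * (1 - (a / M) ^ 2) ^ γ :=
    mul_pos (by positivity) (Real.rpow_pos_of_pos hx0 _)
  rw [ENNReal.ofReal_lt_ofReal_iff hq] at hlt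
  have hpow : (1 - (a / M) ^ 2) ^ γ ≤ (1 - (a / M) ^ 2) ^ θ :=
    Real.rpow_le_rpow_of_exponent_ge hx0 hx1 hγ
  have : M / K * (1 - (a / M) ^ 2) ^ γ ≤ M * (1 - (a / M) ^ 2) ^ θ / K := by
    calc M / K * (1 - (a / M) ^ 2) ^ γ ≤ M / K * (1 - (a / M) ^ 2) ^ θ :=
          mul_le_mul_of_nonneg_left hpow (by positivity)
      _ = M * (1 - (a / M) ^ 2) ^ θ / K := by ring
  linarith

/-! ## §10  Drift families: the lower edge `p = −(2q − 1)γ/2` of the modulus exponent -/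

/-- **`DriftFamily q s δ k a₁`** — parameter drift of order `q` in the amplitude is realised at
every small amplitude: for every `M > 0` there are `c₀ > 0`, `ε₀ > 0` such that at every spin
`a₁M ≤ |a| < M` and every `0 < ε < ε₀` some vacuum datum on `Kerr.slice a M` within `dist < ε`
of the Kerr datum has a maximal development ALL of whose Kerr–Schild `Cᵏ`-limits `(M', a')` have
`|M' − M| + |a' − a| ≥ c₀ε^q`. ON PAPER (dictionary of §9): `q = 1` whenever a Kerr parameter is
unpinned — heavier members `Kerr(M + η, a)` for `δ < −1/2` (`driftFamily_one_of_members` below,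
modulo three facts) and spin-shifted members `Kerr(M, a + η)` restricted to `Kerr.slice a M` for
`δ < 1/2` (drift `= η ≍ dist`); `q = 2` in pinned norms `δ ≥ 1/2` — an outgoing wave packet of
amplitude `≍ ε` radiates `E ≍ ε²` through `𝓘⁺` while `M_ADM = M` is pinned, so `M' = M − E`.
[folklore] -/
def DriftFamily (q : ℝ) (s : ℕ) (δ : ℝ) (k : ℕ) (a₁ : ℝ) : Prop :=
  ∀ (M : ℝ) (hM : 0 < M), ∃ c₀ > (0 : ℝ), ∃ ε₀ > (0 : ℝ), ∀ a : ℝ, a₁ * M ≤ |a| → |a| < M →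
    ∀ ε : ℝ, 0 < ε → ε < ε₀ →
      ∃ (D : InitialDataSet 𝓘(ℝ, E3) (Kerr.slice a M)) (_ : D.metric.HasLeviCivita),
        D.IsVacuumConstraintSolution ∧
          InitialDataSet.dataWeightedSobolevEDist s δ D (Kerr.data M a M hM.le) <
              ENNReal.ofReal ε ∧
            ∃ 𝒟 : VacuumCauchyDevelopment D, 𝒟.IsMaximal ∧
              ∀ (M' a' : ℝ) (𝒟oc : Set 𝒟.carrier),
                𝒟.toSpacetime.ConvergesToKerr 𝒟oc M' a' k → c₀ * ε ^ q ≤ |M' - M| + |a' - a|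

/-- Drift of order `q` is drift of every order `q' ≥ q` (amplitudes `ε < 1`: shrink `ε₀` to
`min ε₀ 1`, then `ε^{q'} ≤ ε^q`). So the refuted corner only grows with `q`, and `q = 1` (a
parameter unpinned) is the strongest instance. -/
theorem DriftFamily.mono {q q' : ℝ} {s : ℕ} {δ : ℝ} {k : ℕ}
    {a₁ : ℝ} (h : DriftFamily q s δ k a₁) (hq : q ≤ q') : DriftFamily q' s δ k a₁ := by
  intro M hM
  obtain ⟨c₀, hc₀, ε₀, hε₀, h⟩ := h M hM
  refine ⟨c₀, hc₀, min ε₀ 1, lt_min hε₀ one_pos, fun a ha haM ε hε hεε₀ ↦ ?_⟩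
  obtain ⟨D, inst, hvac, hdist, 𝒟, hmax, hdrift⟩ :=
    h a ha haM ε hε (hεε₀.trans_le (min_le_left _ _))
  refine ⟨D, inst, hvac, hdist, 𝒟, hmax,
    fun M' a' 𝒟oc hconv ↦ le_trans ?_ (hdrift M' a' 𝒟oc hconv)⟩
  have hε1 : ε ≤ 1 := (hεε₀.trans_le (min_le_right _ _)).le
  exact mul_le_mul_of_nonneg_left (Real.rpow_le_rpow_of_exponent_ge hε hε1 hq) hc₀.le

/-- **The lower edge: a drift family of order `q > 1/2` refutes every modulus exponent
`p < −(2q − 1)γ/2`** (`γ ≥ 0`). At `M = 1`, given the constants `c, C` of `CaptureWith`, put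
`n = 2q − 1`, `B = (C⁺/c₀)²` and choose `χ` so small that `2Bχ^{−2p−nγ} ≤ cⁿ/2` and
`2Bχ^{−2p} ≤ ε₀ⁿ/2` (both exponents POSITIVE iff `p < −nγ/2`, `p < 0`); at the spin
`a = √(1 − χ)` take the drifting datum of amplitude `ε = (2Bχ^{−2p})^{1/n}` (inside the basin).
Capture gives `c₀εq ≤ C⁺χ^{−p}√ε`; squaring and dividing by `ε`, `c₀²εⁿ ≤ C⁺²χ^{−2p}`, i.e.
`2Bc₀² ≤ C⁺²` with `Bc₀² = C⁺²`: absurd. Readings: `q = 1` (a parameter unpinned) ⇒ no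
`p < −γ/2`; `q = 2` (all charges pinned, quadratic radiation) ⇒ no `p < −3γ/2`. Conversely a
Lipschitz resp. quadratic final-parameter bound without κ-factor GIVES `p = −γ/2` resp. `−3γ/2`
(`captureWith_of_linear`; the quadratic case identically with `dist² ≤ cχ^γ·√c χ^{γ/2}·√dist`),
so these edges are sharp modulo those bounds: the exponent `p` records only the conversion
between the drift law and `√dist` at the basin scale — no κ-information lives in it. -/
theorem captureWith_false_of_drift {q : ℝ} {s : ℕ} {δ : ℝ} {k : ℕ} {γ p a₁ : ℝ} (ha₁ : a₁ < 1)
    (H : DriftFamily q s δ k a₁) (hq : 1 / 2 < q) (hγ : 0 ≤ γ)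
    (hp : p < -((2 * q - 1) * γ / 2)) : ¬ CaptureWith s δ k γ p a₁ := by
  intro h
  obtain ⟨c, hc, C, h⟩ := h 1 one_pos
  obtain ⟨c₀, hc₀, ε₀, hε₀, H⟩ := H 1 one_pos
  -- the drift exponent `n = 2q - 1 > 0`; `p < 0`
  set n : ℝ := 2 * q - 1 with hn
  have hn0 : 0 < n := by rw [hn]; linarith
  have hnγ : 0 ≤ n * γ := mul_nonneg hn0.le hγ
  have hp0 : p < 0 := by
    have : -((2 * q - 1) * γ / 2) ≤ 0 := by rw [← hn]; linarith
    linarith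
  -- constants
  set C' : ℝ := max C 0 + 1 with hC'
  have hC'pos : 0 < C' := by positivity
  have hCC' : C ≤ C' := by simp [hC']; linarith [le_max_left C 0]
  have hc₀ne : c₀ ≠ 0 := hc₀.ne'
  set B : ℝ := (C' / c₀) ^ 2 with hB
  have hB0 : 0 < B := by positivity
  have hBne : B ≠ 0 := hB0.ne'
  have hBc : B * c₀ ^ 2 = C' ^ 2 := by rw [hB]; field_simp
  set a₀ : ℝ := max a₁ 0 with ha₀
  have ha₀0 : 0 ≤ a₀ := le_max_right _ _
  have ha₀1 : a₀ < 1 := max_lt ha₁ one_pos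
  have hx₀ : 0 < 1 - a₀ ^ 2 := by nlinarith
  -- the two positive exponents and the choice of `χ`
  set e₂ : ℝ := -2 * p with he₂
  have he₂0 : 0 < e₂ := by rw [he₂]; linarith
  set e₁ : ℝ := e₂ - n * γ with he₁
  have he₁0 : 0 < e₁ := by
    rw [he₁, he₂]
    have : p < -(n * γ / 2) := hp
    linarith
  set q₁ : ℝ := c ^ n / (4 * B) with hq₁
  have hcn : 0 < c ^ n := Real.rpow_pos_of_pos hc _
  have hq₁0 : 0 < q₁ := by positivity
  set q₂ : ℝ := ε₀ ^ n / (4 * B) with hq₂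
  have hε₀n : 0 < ε₀ ^ n := Real.rpow_pos_of_pos hε₀ _
  have hq₂0 : 0 < q₂ := by positivity
  set χ₁ : ℝ := q₁ ^ (1 / e₁) with hχ₁
  have hχ₁0 : 0 < χ₁ := Real.rpow_pos_of_pos hq₁0 _
  set χ₂ : ℝ := q₂ ^ (1 / e₂) with hχ₂
  have hχ₂0 : 0 < χ₂ := Real.rpow_pos_of_pos hq₂0 _
  set χ : ℝ := min (min χ₁ χ₂) (1 - a₀ ^ 2) with hχdef
  have hχ0 : 0 < χ := lt_min (lt_min hχ₁0 hχ₂0) hx₀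
  have hχle : χ ≤ 1 - a₀ ^ 2 := min_le_right _ _
  have hχe₁ : χ ^ e₁ ≤ q₁ := by
    calc χ ^ e₁ ≤ χ₁ ^ e₁ :=
          Real.rpow_le_rpow hχ0.le ((min_le_left _ _).trans (min_le_left _ _)) he₁0.le
      _ = q₁ := by
          rw [hχ₁, ← Real.rpow_mul hq₁0.le, one_div_mul_cancel he₁0.ne', Real.rpow_one]
  have hχe₂ : χ ^ e₂ ≤ q₂ := by
    calc χ ^ e₂ ≤ χ₂ ^ e₂ :=
          Real.rpow_le_rpow hχ0.le ((min_le_left _ _).trans (min_le_right _ _)) he₂0.le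
      _ = q₂ := by
          rw [hχ₂, ← Real.rpow_mul hq₂0.le, one_div_mul_cancel he₂0.ne', Real.rpow_one]
  -- the amplitude `ε = (2 B χ^{e₂})^{1/n}` : `ε^n = 2Bχ^{e₂}`, inside the basin and below `ε₀`
  set T : ℝ := 2 * B * χ ^ e₂ with hT
  have hT0 : 0 < T := by positivity
  set ε : ℝ := T ^ (1 / n) with hεdef
  have hε0 : 0 < ε := Real.rpow_pos_of_pos hT0 _
  have hεn : ε ^ n = T := by
    rw [hεdef, ← Real.rpow_mul hT0.le, one_div_mul_cancel hn0.ne', Real.rpow_one]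
  have hχγ0 : 0 < χ ^ γ := Real.rpow_pos_of_pos hχ0 _
  have hsplit : χ ^ e₂ = χ ^ e₁ * χ ^ (n * γ) := by
    rw [← Real.rpow_add hχ0, he₁, sub_add_cancel]
  have hcχn : (c * χ ^ γ) ^ n = c ^ n * χ ^ (n * γ) := by
    rw [Real.mul_rpow hc.le hχγ0.le, ← Real.rpow_mul hχ0.le, mul_comm γ n]
  have hεbasin : ε < c * χ ^ γ := by
    rw [← Real.rpow_lt_rpow_iff hε0.le (by positivity) hn0, hεn, hcχn]
    calc T = 2 * B * χ ^ e₁ * χ ^ (n * γ) := by rw [hT, hsplit]; ring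
      _ ≤ 2 * B * q₁ * χ ^ (n * γ) :=
          mul_le_mul_of_nonneg_right (mul_le_mul_of_nonneg_left hχe₁ (by positivity))
            (Real.rpow_nonneg hχ0.le _)
      _ = (c ^ n / 2) * χ ^ (n * γ) := by rw [hq₁]; field_simp; ring
      _ < c ^ n * χ ^ (n * γ) := by
          have : 0 < χ ^ (n * γ) := Real.rpow_pos_of_pos hχ0 _
          nlinarith
  have hεε₀ : ε < ε₀ := by
    rw [← Real.rpow_lt_rpow_iff hε0.le hε₀.le hn0, hεn]
    calc T = 2 * B * χ ^ e₂ := rfl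
      _ ≤ 2 * B * q₂ := mul_le_mul_of_nonneg_left hχe₂ (by positivity)
      _ = ε₀ ^ n / 2 := by rw [hq₂]; field_simp; ring
      _ < ε₀ ^ n := by linarith
  -- the spin and the drifting datum
  obtain ⟨ha₀a, ha1, haχ⟩ := spin_of_kappaSq hχ0 ha₀0 hχle
  set a : ℝ := √(1 - χ) with ha_def
  have ha0 : 0 ≤ a := Real.sqrt_nonneg _
  have habs : |a| = a := abs_of_nonneg ha0
  have ha₁a : a₁ * 1 ≤ |a| := by rw [mul_one, habs]; exact (le_max_left _ _).trans ha₀a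
  have hsub : Kerr.IsSubextremal 1 a := by show |a| < 1; rwa [habs]
  have hχa : 1 - (a / 1) ^ 2 = χ := by rw [div_one]; exact haχ
  obtain ⟨D, inst, hvacD, hdist, 𝒟, hmax, hdrift⟩ := H a ha₁a (by rwa [habs]) ε hε0 hεε₀
  haveI := inst
  have hbasin : InitialDataSet.dataWeightedSobolevEDist s δ D (Kerr.data 1 a 1 one_pos.le) <
      ENNReal.ofReal (c * (1 - (a / 1) ^ 2) ^ γ) := by
    rw [hχa]
    exact hdist.trans_le (ENNReal.ofReal_le_ofReal hεbasin.le)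
  obtain ⟨M', a', 𝒟oc, -, -, hconv, hmod⟩ := h a ha₁a hsub D hvacD hbasin 𝒟 hmax
  have hdr := hdrift M' a' 𝒟oc hconv
  -- `c₀ ε^q ≤ |M' - 1| + |a' - a| ≤ C' χ^{-p} √ε`
  set d : ℝ := (InitialDataSet.dataWeightedSobolevEDist s δ D (Kerr.data 1 a 1 one_pos.le)).toReal
    with hddef
  have hd0 : 0 ≤ d := ENNReal.toReal_nonneg
  have hdε : d < ε := ENNReal.toReal_lt_of_lt_ofReal hdist
  have hxp0 : 0 < χ ^ (-p) := Real.rpow_pos_of_pos hχ0 _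
  have hchain : c₀ * ε ^ q ≤ C' * χ ^ (-p) * √ε := by
    calc c₀ * ε ^ q ≤ |M' - 1| + |a' - a| := hdr
      _ ≤ C * (1 - (a / 1) ^ 2) ^ (-p) * √d := hmod
      _ = C * χ ^ (-p) * √d := by rw [hχa]
      _ ≤ C' * χ ^ (-p) * √d :=
          mul_le_mul_of_nonneg_right (mul_le_mul_of_nonneg_right hCC' hxp0.le) (Real.sqrt_nonneg _)
      _ ≤ C' * χ ^ (-p) * √ε :=
          mul_le_mul_of_nonneg_left (Real.sqrt_le_sqrt hdε.le) (by positivity)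
  -- square: `c₀² ε^{2q} ≤ C'² χ^{e₂} ε`, with `ε^{2q} = ε^n ε` and `(χ^{-p})² = χ^{e₂}`
  have hεq0 : 0 ≤ ε ^ q := Real.rpow_nonneg hε0.le _
  have hsq : (c₀ * ε ^ q) ^ 2 ≤ (C' * χ ^ (-p) * √ε) ^ 2 :=
    pow_le_pow_left₀ (by positivity) hchain 2
  have hxsq : (χ ^ (-p)) ^ 2 = χ ^ e₂ := by
    rw [pow_two, ← Real.rpow_add hχ0, he₂]
    congr 1
    ring
  have hεsq : (√ε) ^ 2 = ε := Real.sq_sqrt hε0.le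
  have hε2q : (ε ^ q) ^ 2 = ε ^ n * ε := by
    rw [pow_two, ← Real.rpow_add hε0, ← Real.rpow_add_one hε0.ne', hn]
    congr 1
    ring
  have key : c₀ ^ 2 * (ε ^ n * ε) ≤ C' ^ 2 * χ ^ e₂ * ε := by
    have h1 : (c₀ * ε ^ q) ^ 2 = c₀ ^ 2 * (ε ^ q) ^ 2 := by ring
    have h2 : (C' * χ ^ (-p) * √ε) ^ 2 = C' ^ 2 * (χ ^ (-p)) ^ 2 * (√ε) ^ 2 := by ring
    rw [h1, h2, hε2q, hxsq, hεsq] at hsq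
    exact hsq
  -- divide by `ε > 0` and substitute `ε^n = 2Bχ^{e₂}`, `B c₀² = C'²`
  have key' : c₀ ^ 2 * ε ^ n ≤ C' ^ 2 * χ ^ e₂ := by
    refine le_of_mul_le_mul_right ?_ hε0
    calc c₀ ^ 2 * ε ^ n * ε = c₀ ^ 2 * (ε ^ n * ε) := by ring
      _ ≤ C' ^ 2 * χ ^ e₂ * ε := key
  have hχe₂0 : 0 < χ ^ e₂ := Real.rpow_pos_of_pos hχ0 _
  have h2 : 2 * (C' ^ 2 * χ ^ e₂) ≤ C' ^ 2 * χ ^ e₂ := by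
    calc 2 * (C' ^ 2 * χ ^ e₂) = (B * c₀ ^ 2) * (2 * χ ^ e₂) := by rw [hBc]; ring
      _ = c₀ ^ 2 * (2 * B * χ ^ e₂) := by ring
      _ = c₀ ^ 2 * ε ^ n := by rw [hεn, hT]
      _ ≤ C' ^ 2 * χ ^ e₂ := key'
  have hpos : 0 < C' ^ 2 * χ ^ e₂ := mul_pos (pow_pos hC'pos 2) hχe₂0
  linarith

/-- The same for an arbitrary basin exponent: every `p < −(2q − 1)·max γ 0/2` is refuted (raise
`γ` to `max γ 0` by `captureWith_mono` first). -/
theorem captureWith_false_of_drift' {q : ℝ} {s : ℕ} {δ : ℝ} {k : ℕ} {γ p a₁ : ℝ} (ha₁ : a₁ < 1)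
    (H : DriftFamily q s δ k a₁) (hq : 1 / 2 < q) (hp : p < -((2 * q - 1) * max γ 0 / 2)) :
    ¬ CaptureWith s δ k γ p a₁ :=
  fun h ↦ captureWith_false_of_drift ha₁ H hq (le_max_right _ _) hp
    (captureWith_mono h le_rfl le_rfl le_rfl (le_max_left _ _) le_rfl le_rfl)

/-- **The modulus line `p = −γ/2` is sharp where a parameter is unpinned** (modulo the two paper
inputs): granted a drift family of order one, no `p < −γ/2` is admissible at basin exponent
`γ ≥ 0`; granted a Lipschitz final-parameter map on the basin `cχ^γ` (`LinearCaptureWith` —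
what AKU's foliation picture gives in a topology in which the Kerr family is continuous, i.e.
`δ < 1/2`), `p = −γ/2` IS admissible (landed `captureWith_of_linear`). -/
theorem modulusLine_sharp {s : ℕ} {δ : ℝ} {k : ℕ} {γ a₁ : ℝ} (ha₁ : a₁ < 1) (hγ : 0 ≤ γ)
    (H : DriftFamily 1 s δ k a₁) :
    (∀ p : ℝ, p < -(γ / 2) → ¬ CaptureWith s δ k γ p a₁) ∧
      (LinearCaptureWith s δ k γ a₁ → CaptureWith s δ k γ (-(γ / 2)) a₁) :=
  ⟨fun _ hp ↦ captureWith_false_of_drift ha₁ H (by norm_num) hγ (by linarith),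
    captureWith_of_linear⟩

/-- **H_dist⁺(s, δ, a₁)** — distance of the heavier members: for every `M > 0` there are `K` and
`η₀ > 0` with `dist_{s,δ}(Kerr.data (M + η) a M, Kerr.data M a M) ≤ Kη` for all spins
`a₁M ≤ |a| < M` and all `0 < η < η₀`. TRUE on paper iff `δ < −1/2` (the Kerr–Schild form is affine
in the mass at fixed `a`; `‖(1 + |y|)^δ r⁻¹‖_{L²} < ∞` iff `δ < −1/2`), `dist = ⊤` otherwise.
Bartnik, CPAM 39 (1986), (1.2). [folklore] -/
def HeavierMemberDistBound (s : ℕ) (δ a₁ : ℝ) : Prop :=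
  ∀ (M : ℝ) (hM : 0 < M), ∃ K : ℝ, ∃ η₀ > (0 : ℝ), ∀ (a η : ℝ), a₁ * M ≤ |a| → |a| < M →
    (hη : 0 < η) → η < η₀ →
      InitialDataSet.dataWeightedSobolevEDist s δ
          (Kerr.data (M + η) a M (by linarith)) (Kerr.data M a M hM.le) ≤
        ENNReal.ofReal (K * η)

/-- **H_rig(k, a₁)** — rigidity of the heavier members' developments: for `a₁M ≤ |a| < M` and
`η > 0` the datum `Kerr.data (M + η) a M` has a maximal vacuum Cauchy development (Choquet-Bruhat–
Geroch) all of whose Kerr–Schild `Cᵏ`-limits have mass `M' = M + η` (the Kerr–Schild radius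
depends on `a` only, so the edge `{r = M}` stays inside the bigger horizon; the MGHD contains the
whole future exterior of `Kerr(M + η, a)`, which is `Cᵏ`-close on late slabs to no Kerr metric of
another mass: codimension-0 `C⁰` rigidity of the Kerr family in the mass). [folklore] -/
def HeavierMemberRigid (k : ℕ) (a₁ : ℝ) : Prop :=
  ∀ (M : ℝ) (_ : 0 < M) (a η : ℝ), a₁ * M ≤ |a| → |a| < M → (hη : 0 < η) →
    ∃ (_ : (Kerr.data (M + η) a M (by linarith)).metric.HasLeviCivita)
      (𝒟 : VacuumCauchyDevelopment (Kerr.data (M + η) a M (by linarith))),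
      𝒟.IsMaximal ∧ ∀ (M' a' : ℝ) (𝒟oc : Set 𝒟.carrier),
        𝒟.toSpacetime.ConvergesToKerr 𝒟oc M' a' k → M' = M + η

/-- **The heavier members are a drift family of order one** (modulo the vacuum constraints of
Kerr–Schild slice data — named fact `Kerr.data_isVacuumConstraintSolution`, a tree theorem for
`a = 0` only — `H_dist⁺` and `H_rig`): with `K' = max K 0 + 1`, `c₀ = 1/(2K')`, `ε₀ = K'η₀`, at
amplitude `ε` take `η = ε/(2K')`; then `dist ≤ Kη ≤ ε/2 < ε` and every limit has
`|M' − M| = η = c₀ε`. Exactly parallel to `truncationTrap_one_of_lighterMembers` (§6). -/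
theorem driftFamily_one_of_members {s : ℕ} {δ : ℝ} {k : ℕ} {a₁ : ℝ}
    (hvac : ∀ m a r₀ : ℝ, Kerr.data_isVacuumConstraintSolution m a r₀)
    (hdist : HeavierMemberDistBound s δ a₁) (hrig : HeavierMemberRigid k a₁) :
    DriftFamily 1 s δ k a₁ := by
  intro M hM
  obtain ⟨K, η₀, hη₀, hK⟩ := hdist M hM
  set K' : ℝ := max K 0 + 1 with hK'
  have hK'pos : 0 < K' := by positivity
  have hKK' : K ≤ K' := by simp [hK']; linarith [le_max_left K 0]
  refine ⟨1 / (2 * K'), by positivity, K' * η₀, by positivity, fun a ha haM ε hε hεε₀ ↦ ?_⟩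
  set η : ℝ := ε / (2 * K') with hηdef
  have hη : 0 < η := by positivity
  have hηη₀ : η < η₀ := by
    rw [hηdef, div_lt_iff₀ (by positivity)]
    calc ε < K' * η₀ := hεε₀
      _ ≤ η₀ * (2 * K') := by nlinarith [mul_pos hK'pos hη₀]
  have hpos : 0 ≤ M + η := by linarith
  obtain ⟨inst, 𝒟, hmax, hlim⟩ := hrig M hM a η ha haM hη
  haveI := inst
  refine ⟨Kerr.data (M + η) a M hpos, inst, hvac (M + η) a M hpos, ?_, 𝒟, hmax, ?_⟩
  · refine (hK a η ha haM hη hηη₀).trans_lt ((ENNReal.ofReal_lt_ofReal_iff hε).mpr ?_)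
    calc K * η ≤ K' * η := mul_le_mul_of_nonneg_right hKK' hη.le
      _ = ε / 2 := by rw [hηdef]; field_simp
      _ < ε := by linarith
  · intro M' a' 𝒟oc hconv
    rw [hlim M' a' 𝒟oc hconv, Real.rpow_one]
    have : |M + η - M| = η := by rw [add_sub_cancel_left, abs_of_pos hη]
    rw [this, hηdef]
    calc 1 / (2 * K') * ε = ε / (2 * K') := by ring
      _ ≤ ε / (2 * K') + |a' - a| := le_add_of_nonneg_right (abs_nonneg _)

/-- **The corner `p < −γ/2` is false modulo three Kerr facts** (`δ < −1/2` on paper): granted the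
vacuum constraints of Kerr–Schild slice data, `H_dist⁺(s, δ, a₁)` and `H_rig(k, a₁)`, capture
with `p < −max γ 0 / 2` FAILS. -/
theorem captureWith_false_of_members {s : ℕ} {δ : ℝ} {k : ℕ} {γ p a₁ : ℝ} (ha₁ : a₁ < 1)
    (hvac : ∀ m a r₀ : ℝ, Kerr.data_isVacuumConstraintSolution m a r₀)
    (hdist : HeavierMemberDistBound s δ a₁) (hrig : HeavierMemberRigid k a₁)
    (hp : p < -(max γ 0 / 2)) : ¬ CaptureWith s δ k γ p a₁ :=
  captureWith_false_of_drift' ha₁ (driftFamily_one_of_members hvac hdist hrig) (by norm_num)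
    (by linarith)

/-! ## §11  Targets: the registered skeleton `Lines/unit-temperature-front-face.lean`

(payload `targets`/`stuck_stubs` empty this cycle; the lead PICKED `polynomial-closure`, whose
stubs `stub_kappaPolynomialTeukolskyLaw` / `stub_polynomialClosing` the drefute seat found
MIS-TYPED — admissible Teukolsky fields have data supported away from `𝓗⁺`, so no finite constant
transfers to the horizon-crossing crux data; corrected signatures in `DrefuteCorrected.lean`.)
Cheap attacks on the four registered stubs of `unit-temperature-front-face`, none a kill:
* S1 `stub_unitTemperatureFace` — explicit real algebra; clauses (ii)/(iii) are mutually
  consistent at `σ = 0` (`r₊(M, M) = M` ⇒ `G 0 0 θ 0 1 = 2M²(1 + c²)`; `∂ₓG₀₀(0) = −4M²(1 + c²) =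
  −2G₀₁`) and were certified numerically against the tree's Kerr–Schild conventions by three seats
  (triage r1-2 E3, r1-3 P2, planner rev 2: all ten components, `O(σ)` rate). TRUE; not a target.
* S2 `stub_faceRedShift` — a pointwise positive-semidefiniteness claim for an explicit 4×4 form.
  Mutations: the collar `|r − r₊| ≤ θ₀(r₊ − r₋)` needs `θ₀ < 1/2` to stay red-shifted
  (`r − M = (r₊ − r₋)(1/2 − θ₀) > 0` at its inner end) and `θ₀ < r₊/(r₊ − r₋)` to avoid `r = 0` —
  both available since `θ₀` is existential AFTER nothing but `M`; the horizon identity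
  `K^N|_{r₊} = 2Hh₁λ² + ½f₁|q̸|² + 2Hκv² − (4Hr₊/Σ)λv + (2r₊/Σ)v(q̸·∇̸r)` is consistent with
  `∇r|_{r₊} = ((r₊² + a²)/Σ)K`, `ℓ(K)|_{r₊} = Σ₊/(2Mr₊)`; off the horizon the `A/κ`-sized new terms
  carry a factor `Δ/Σ = O(θ₀κ²)` or `g(K, K) = O(κ²θ₀)`. Plausible with `N₁ = 1`; no reason found
  to expect falsity; provable-now per its author. Not a target.
* S3 `stub_thermalTimeStability` — anchored Cauchy stability up to `t* = T/κ` with polynomial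
  loss. Checked for a STRUCTURAL kill near the slice edge: the slab `{t* = τ, r > M}` lies in
  `D⁺` of `{t* = 0, r > M}` in exact Kerr because `r` (on `r₋ < r < r₊`) and `t*` are both time
  functions, the Cauchy horizon from the edge sphere leans AWAY from the slab (into `r < M`); the
  margin `|g(∇r, ∇r)| = (r₊ − M)(M − r₋)/Σ = M²χ/Σ` at the edge degenerates only POLYNOMIALLY, so
  `C⁰`-small perturbations (`√dist ≤ √c χ^{γ/2}`, `γ` large) keep the slab inside their own domain
  of dependence. At `dist = 0` S3 asks for an isometric copy of the Kerr slab in the abstract MGHD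
  (true by maximality once the Kerr slab is a `VacuumCauchyDevelopment` — needs Kerr Ricci-flatness,
  in the tree so far only for Schwarzschild, `SchwarzschildKerrSchildRicciFlat.lean`). No kill; XL.
* S4 `stub_captureTransfer` — its type is `S3-conclusion → KappaExplicitWaveDecay →
  (∀ [..], ∃ exps, CaptureWithoutSub …)`, and `CaptureWithoutSub ↔` crux (`near_iff_withoutSub`):
  so the crux implies S4 outright, and given S3's conclusion and the sibling crux S4 IS the crux.
  Everything in this file applies to S4 verbatim (in particular §§9–10: its `∃ (γ, p)` must land in
  `{γ ≥ 1, p ≥ −γ/2}` for `δ < 1/2` resp. `{γ ≥ 1/2, p ≥ −3γ/2}` for `δ ≥ 1/2`, and a kill needs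
  super-polynomial degeneration).
-/

end Summit.FinalStateConjecture.FinalStateConjecture.Cruxes.NearExtremalKappaCapture.Disproof

end
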